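import Mathlib
import Summits.Ventures.PercRepro2.SwOutCrossGenThm

/-!
# The generic cross-arm cube: the abstract theorem under the THREE-MOVE closure (blind cell
PercRepro2, night-4 g26, 2026-08-28; proofs/NIGHT4-G26.md §3)

The proof of `card_le_crossGen` uses the hypothesis «`𝒯` is an up-set of types» in exactly three
places, each a single MOVE on types: (i) fewer red u-arms at the same label (`isLowerSet_DG`);
(ii) at the same u-arm bits, from the label of the flip of a lower core point to the label of the
point (`DG_flip_subset`); (iii) from the top slab at a non-core point without red-side leak to the
bottom slab at the image of the slab injection (`card_slab_leG`).  `IsUpW F 𝒯` is closure under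
these three moves alone; **`card_le_crossGen'`** is the abstract theorem under it — the same proof
with the three uses replaced.  Every up-set is closed under the moves (`isUpW_of_isUpG`), but the
converse fails, and the difference is what the MARK AT A DROPPED VERTEX needs: an order on types
that depends on the u-arm bits (`SwOutCrossGenMark`), for which the cube theorem follows from this
file without a new injection.
-/

namespace Summit.Ventures.PercRepro2

namespace CrossArm

open LocRows

variable {W A L : Type*} {F : FibreData W A L} {ι : Type*}

open scoped Classical

/-- **Closure under the three moves of the abstract proof**: (i) fewer red u-arms at the same
label; (ii) at any u-arm bits, from the label of the flip of a lower core point to the label of the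
point; (iii) from the top slab at a non-core point without red-side leak to the bottom slab at its
image under the slab injection. -/
def IsUpW (F : FibreData W A L) (𝒯 : Set (TypG L ι)) : Prop :=
  (∀ (s s' : Config ι) (l : L), (∀ j, s j = false → s' j = false) → (s, l) ∈ 𝒯 → (s', l) ∈ 𝒯) ∧
  (∀ w ∈ F.core0, ∀ s : Config ι, (s, F.label (F.flip w)) ∈ 𝒯 → (s, F.label w) ∈ 𝒯) ∧
  (∀ w, F.leakR w = false → F.core w = false →
    ((sTopG : Config ι), F.label w) ∈ 𝒯 → ((sBotG : Config ι), F.label (F.psi w)) ∈ 𝒯)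

/-- Every up-set of types is closed under the three moves. -/
theorem isUpW_of_isUpG {𝒯 : Set (TypG L ι)} (h : IsUpG F 𝒯) : IsUpW F 𝒯 := by
  refine ⟨fun s s' l hs hl => h _ hl _ ⟨hs, F.betterL_refl _⟩,
    fun w hw s hs => h _ hs _ ⟨fun _ h' => h', F.pair_label w hw⟩,
    fun w hr hc ht => h _ ht _ ⟨fun j hj => ?_, (F.psi_ok w hr hc).2.2.1⟩⟩
  exact absurd hj (by simp [sTopG])

section Core

variable {𝒯 : Set (TypG L ι)} {𝓔 : Set (Set (AtomG A ι))}

/-- `DG w` is a lower set (three-move closure). -/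
lemma isLowerSet_DG' (h𝒯 : IsUpW F 𝒯) (w : W) : IsLowerSet (DG F 𝒯 w) := by
  intro s s' hle hs
  refine h𝒯.1 s s' _ (fun j hj => ?_) hs
  have := hle j
  rw [hj] at this
  cases h' : s' j with
  | false => rfl
  | true =>
    rw [h'] at this
    exact absurd (Bool.le_iff_imp.1 this rfl) (by decide)

/-- `DG (flip w) ⊆ DG w` for a lower core point (three-move closure). -/
lemma DG_flip_subset' (h𝒯 : IsUpW F 𝒯) {w : W} (hw : w ∈ F.core0) :
    DG F 𝒯 (F.flip w) ⊆ DG F 𝒯 w := fun s hs => h𝒯.2.1 w hw s hs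

variable [Fintype ι] [DecidableEq ι]

/-- The cube principle on a fibre point (three-move closure). -/
theorem card_DG_AG_le' (h𝒯 : IsUpW F 𝒯) (h𝓔 : IsUpperSet 𝓔) (w : W) :
    (Finset.univ.filter (· ∈ DG F 𝒯 w ∩ AG F 𝓔 w)).card ≤
      (Finset.univ.filter (· ∈ DG F 𝒯 w ∩ FlG F 𝓔 w)).card :=
  card_inter_le_of_cube (isLowerSet_DG' h𝒯 w) (isUpperSet_AG h𝓔 w) (isLowerSet_FlG h𝓔 w)
    (flipAll_preimage_FlG w)

/-- The paired core inequality (three-move closure). -/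
theorem pair_card_le' (h𝒯 : IsUpW F 𝒯) (h𝓔 : IsUpperSet 𝓔) {w : W} (hw : w ∈ F.core0) :
    (Finset.univ.filter (· ∈ DG F 𝒯 w ∩ AG F 𝓔 w)).card +
      (Finset.univ.filter (· ∈ DG F 𝒯 (F.flip w) ∩ AG F 𝓔 (F.flip w))).card ≤
    (Finset.univ.filter (· ∈ DG F 𝒯 w ∩ FlG F 𝓔 (F.flip w))).card +
      (Finset.univ.filter (· ∈ DG F 𝒯 (F.flip w) ∩ FlG F 𝓔 w)).card := by
  have h1 := card_DG_AG_le' h𝒯 h𝓔 w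
  have h2 := card_DG_AG_le' h𝒯 h𝓔 (F.flip w)
  have r := card_rearrG (DG_flip_subset' h𝒯 hw) (FlG_subset_flip h𝓔 hw)
  omega

end Core

section Count

variable {𝒯 : Set (TypG L ι)} [Fintype ι] [DecidableEq ι] [Fintype W] [DecidableEq W]

/-- The core inequality (three-move closure). -/
theorem core_le' (h𝒯 : IsUpW F 𝒯) {𝓔 : Set (Set (AtomG A ι))} (h𝓔 : IsUpperSet 𝓔) :
    ((QG F 𝒯).filter fun q => ERG F q ∈ 𝓔 ∧ F.core q.2 = true).card ≤
      ((QG F 𝒯).filter fun q => EBG F q ∈ 𝓔 ∧ F.core q.2 = true).card := by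
  rw [card_core_eqG, card_core_eqG]
  refine Finset.sum_le_sum fun w hw => ?_
  have hc := F.core0_core w hw
  have hc' := F.core_flip w hc
  rw [card_core_ERG 𝓔 w hc, card_core_ERG 𝓔 (F.flip w) hc', card_core_EBG 𝓔 w hc,
    card_core_EBG 𝓔 (F.flip w) hc', F.flip_flip]
  exact pair_card_le' h𝒯 h𝓔 hw

variable [Nonempty ι]

omit [DecidableEq W] in
/-- The slab injection (three-move closure): the red T-slab count is at most the blue B-slab
count. -/
lemma card_slab_leG' (h𝒯 : IsUpW F 𝒯) {𝓔 : Set (Set (AtomG A ι))} (h𝓔 : IsUpperSet 𝓔) :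
    ((QG F 𝒯).filter fun q => ERG F q ∈ 𝓔 ∧ F.core q.2 = false ∧ q.1 = sTopG).card ≤
      ((QG F 𝒯).filter fun q => EBG F q ∈ 𝓔 ∧ F.core q.2 = false ∧ q.1 = sBotG).card := by
  refine Finset.card_le_card_of_injOn (fun q => ((sBotG : Config ι), F.psi q.2)) ?_ ?_
  · intro q hq
    rw [Finset.mem_coe, Finset.mem_filter, mem_QG] at hq
    obtain ⟨⟨hnl, ht⟩, hE, hc, hs⟩ := hq
    have hR : F.leakR q.2 = false := by
      cases hL : F.leakR q.2 with
      | false => rfl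
      | true => exact absurd (Or.inl ⟨hs ▸ redUG_top, hL⟩) hnl
    obtain ⟨hB, hc', -, hred⟩ := F.psi_ok q.2 hR hc
    rw [Finset.mem_coe, Finset.mem_filter, mem_QG]
    refine ⟨⟨?_, ?_⟩, ?_, hc', rfl⟩
    · rintro (⟨h, -⟩ | ⟨-, h⟩)
      · exact not_redUG_bot h
      · rw [hB] at h; exact Bool.noConfusion h
    · have ht' : ((sTopG : Config ι), F.label q.2) ∈ 𝒯 := by
        rw [← hs]; exact ht
      exact h𝒯.2.2 q.2 hR hc ht'
    · rw [EBG_eq, flipAll_sBotG]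
      refine h𝓔 ?_ hE
      have hqw : q = (sTopG, q.2) := Prod.ext hs rfl
      rw [hqw]
      exact ERG_mono_fib _ hred
  · intro q hq q' hq' heq
    rw [Finset.mem_coe, Finset.mem_filter, mem_QG] at hq hq'
    have heq' : F.psi q.2 = F.psi q'.2 := (Prod.mk.inj heq).2
    obtain ⟨⟨hnl, -⟩, -, hc, hs⟩ := hq
    obtain ⟨⟨hnl', -⟩, -, hc', hs'⟩ := hq'
    have hR : F.leakR q.2 = false := by
      cases hL : F.leakR q.2 with
      | false => rfl
      | true => exact absurd (Or.inl ⟨hs ▸ redUG_top, hL⟩) hnl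
    have hR' : F.leakR q'.2 = false := by
      cases hL : F.leakR q'.2 with
      | false => rfl
      | true => exact absurd (Or.inl ⟨hs' ▸ redUG_top, hL⟩) hnl'
    exact Prod.ext (hs.trans hs'.symm) (F.psi_inj _ _ hR hc hR' hc' heq')

/-- **THE ABSTRACT THEOREM UNDER THE THREE-MOVE CLOSURE**: on every family of types closed under
the three moves, the red count is at most the blue count for every up-set of atom sets. -/
theorem card_le_crossGen' (h𝒯 : IsUpW F 𝒯) {𝓔 : Set (Set (AtomG A ι))} (h𝓔 : IsUpperSet 𝓔) :
    ((QG F 𝒯).filter fun q => ERG F q ∈ 𝓔).card ≤ ((QG F 𝒯).filter fun q => EBG F q ∈ 𝓔).card := by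
  by_cases hE : (∅ : Set (AtomG A ι)) ∈ 𝓔
  · have hall : ∀ A : Set (AtomG A ι), A ∈ 𝓔 := fun A => h𝓔 (Set.empty_subset A) hE
    rw [Finset.filter_true_of_mem fun _ _ => hall _, Finset.filter_true_of_mem fun _ _ => hall _]
  rw [card_splitG (F := F) (𝒯 := 𝒯) (fun q => ERG F q ∈ 𝓔),
    card_splitG (F := F) (𝒯 := 𝒯) (fun q => EBG F q ∈ 𝓔)]
  have hB0 : ((QG F 𝒯).filter fun q => ERG F q ∈ 𝓔 ∧ F.core q.2 = false ∧ q.1 = sBotG).card = 0 := by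
    rw [Finset.card_eq_zero, Finset.filter_eq_empty_iff]
    rintro q - ⟨hE', -, hs⟩
    apply hE
    have : ERG F q = ∅ := by
      rw [show q = (q.1, q.2) from rfl, hs]
      exact ERG_sBot q.2
    rw [this] at hE'
    exact hE'
  have hT0 : ((QG F 𝒯).filter fun q => EBG F q ∈ 𝓔 ∧ F.core q.2 = false ∧ q.1 = sTopG).card = 0 := by
    rw [Finset.card_eq_zero, Finset.filter_eq_empty_iff]
    rintro q - ⟨hE', -, hs⟩
    apply hE
    have : EBG F q = ∅ := by
      rw [show q = (q.1, q.2) from rfl, hs]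
      exact EBG_sTop q.2
    rw [this] at hE'
    exact hE'
  have hcore := core_le' h𝒯 h𝓔
  have hslab := card_slab_leG' h𝒯 h𝓔
  omega

/-- The landed theorem is the special case of an up-set of types. -/
theorem card_le_crossGen_of_isUpG (h𝒯 : IsUpG F 𝒯) {𝓔 : Set (Set (AtomG A ι))}
    (h𝓔 : IsUpperSet 𝓔) :
    ((QG F 𝒯).filter fun q => ERG F q ∈ 𝓔).card ≤ ((QG F 𝒯).filter fun q => EBG F q ∈ 𝓔).card :=
  card_le_crossGen' (isUpW_of_isUpG h𝒯) h𝓔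

end Count

end CrossArm

end Summit.Ventures.PercRepro2
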